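import Summits.FinalStateConjecture.FinalStateConjecture.Theses.PhotonSphereChannels
import Literature.Geometry.Lorentzian.StationaryBlackHoleUniqueness

/-!
# Sketch — crux-ideate stmt-FinalStateConjecture-14075 (K2R = `ChannelsResolveTameDevelopmentsR`),
# ideator 3, round 1: first lemmas of the three idea cards

* `StableSetSwallowsOmegaLimit` — card `hull-minimal-sets-hand-you-global-t` (pure topological
  dynamics over Mathlib's `Flow` / `omegaLimit`: the ω-limit set of a precompact forward orbit is
  internally chain transitive, so a nonempty closed invariant subset that is asymptotically stable
  RELATIVE to the ω-limit set is all of it; Hirsch–Smith–Zhao 2001, Lemma 2.1′ + Thm. 3.1/3.2).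
* `LogShellSmoothing`, `EternalDarkModesVanish` — card `one-log-two-readings` (linear,
  Regge–Wheeler family on Schwarzschild, over `Literature.Geometry.Lorentzian.ReggeWheeler`).
* `kerr_zeroEnergyRadial_deriv` (PROVED) and `ZeroEnergyLightFallsIn`,
  `NoHairFromInfallingZeroEnergyLight` — card `zero-energy-light-cannot-hover`
  (over `StationaryAFBlackHole`, `IsNullGeodesicIn`, `AlexakisIonescuKlainermanRigidity`).
-/

noncomputable section

open Filter Set MeasureTheory
open scoped ENNReal Topology Manifold ContDiff

namespace Summit.FinalStateConjecture.FinalStateConjecture.Cruxes.ChannelsResolveTameDevelopmentsR.Ideator3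

/-! ## Card 1 — Birkhoff–Conley on the dark hull -/

/-- **Stable sets swallow ω-limit sets.** For a continuous real flow `ϕ` on a metric space and a
point `x` with precompact forward orbit, let `Ω = ω⁺(x)`.  If `A ⊆ Ω` is nonempty, closed,
invariant, Lyapunov-stable relative to `Ω` and attracts a relative neighbourhood of itself in `Ω`,
then `Ω ⊆ A` (hence `Ω = A`).  Proof in print: `Ω` is compact, connected, invariant and internally
chain transitive (Hirsch–Smith–Zhao, J. Dyn. Diff. Eq. 13 (2001), Lemma 2.1′); a relatively
asymptotically stable compact invariant set is an attractor of `ϕ|_Ω`, and an internally chain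
transitive set meeting the basin of an attractor lies in it (ibid. Thm. 3.1/3.2; Conley 1978).
Application (card): `Ω` = the dark hull ω-limit set of a tame development, `A` = its sub-extremal
Kerr members; relative asymptotic stability = capture among DARK tame neighbours only. -/
def StableSetSwallowsOmegaLimit : Prop :=
  ∀ (X : Type) [MetricSpace X] (ϕ : Flow ℝ X) (x : X),
    IsCompact (closure (⋃ t ∈ Ici (0 : ℝ), {ϕ t x})) →
    ∀ A : Set X, A.Nonempty → IsClosed A → IsInvariant ϕ A →
      A ⊆ omegaLimit atTop (fun t y ↦ ϕ t y) {x} →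
      (∀ ε > 0, ∃ δ > 0, ∀ y ∈ omegaLimit atTop (fun t y ↦ ϕ t y) {x},
          Metric.infDist y A < δ → ∀ t ≥ (0 : ℝ), Metric.infDist (ϕ t y) A < ε) →
      (∃ δ₀ > 0, ∀ y ∈ omegaLimit atTop (fun t y ↦ ϕ t y) {x}, Metric.infDist y A < δ₀ →
          Tendsto (fun t ↦ Metric.infDist (ϕ t y) A) atTop (𝓝 0)) →
      omegaLimit atTop (fun t y ↦ ϕ t y) {x} ⊆ A

/-- **Minimal sets are points or recurrent.** In the same setting every nonempty compact invariant
subset of `Ω` contains a nonempty closed invariant subset `K` which is MINIMAL (no proper nonempty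
closed invariant subset); and a minimal `K` is either a single fixed point of the flow or every
point of `K` is non-stationary and uniformly recurrent (Birkhoff).  Stated here in the weak form
the card uses: a minimal set all of whose points are fixed is a singleton, and a minimal set
containing a non-fixed point contains no fixed point. [Birkhoff 1927, Ch. VII; folklore] -/
def MinimalSetDichotomy : Prop :=
  ∀ (X : Type) [MetricSpace X] (ϕ : Flow ℝ X) (K : Set X),
    K.Nonempty → IsCompact K → IsInvariant ϕ K →
    (∀ K' ⊆ K, K'.Nonempty → IsClosed K' → IsInvariant ϕ K' → K' = K) →
      (∃ p, K = {p} ∧ ∀ t, ϕ t p = p) ∨ (∀ p ∈ K, ∃ t, ϕ t p ≠ p)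

/-! ## Card 2 — one log, two readings (linear Regge–Wheeler shadow) -/

open Literature.Geometry.Lorentzian Literature.Geometry.Lorentzian.ReggeWheeler

/-- **Log-shell smoothing (the time-domain reading of the log-ball).** For the Regge–Wheeler family
on Schwarzschild (`s ≤ 2 ≤ …`, `ℓ ≥ s`) and every log-shell `{|x − x_c| < ρ₀ + C log(ℓ+1)}` about the
photon sphere there is `D = D(M, ρ₀, C)` such that data SUPPORTED IN THE SHELL spend a total local
energy-time in the shell of at most `D (1 + log(ℓ+1))` times their energy:
`∫_0^∞ E[ψ(t); shell] dt ≤ D (1 + log(ℓ+1)) · E[ψ(0)]`, uniformly in `s, ℓ` and the tortoise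
normalisation.  In print this is Kato smoothing from the log-loss cutoff resolvent bound at a
normally hyperbolic barrier top (Wunsch–Zworski 2011; Bony–Häfner 2008 for Schwarzschild–de Sitter;
Burq 2004) plus the fixed-ℓ low-frequency theory (Donninger–Schlag–Soffer 2011, Price law for every
ℓ).  The `log(ℓ+1)` is the Ehrenfest time `λ⁻¹ log ℓ`, `λ = 1/(3√3 M)` — the SAME logarithm as the
log-ball `C log(ℓ+1)` of `UniformPhotonSphereChannelsR`. [conjectural; first lemma of the card] -/
def LogShellSmoothing : Prop :=
  ∀ M : ℝ, 0 < M → ∀ ρ₀ C : ℝ, 0 ≤ ρ₀ → 0 ≤ C → ∃ D : ℝ, 0 < D ∧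
    ∀ (r : ℝ → ℝ) (xc : ℝ), IsTortoiseRadius M r xc → ∀ (s ℓ : ℕ), s ≤ 2 → s ≤ ℓ →
      ∀ ψ : ℝ → ℝ → ℝ, IsRWSolution M s ℓ r ψ →
        CauchyDataSupportedOn ψ {x : ℝ | |x - xc| < ρ₀ + C * Real.log ((ℓ : ℝ) + 1)} →
        ∫⁻ t in Ici (0 : ℝ),
            (∫⁻ x in {x : ℝ | |x - xc| < ρ₀ + C * Real.log ((ℓ : ℝ) + 1)},
              ENNReal.ofReal (energyDensity (linePotential M s ℓ r) ψ t x))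
          ≤ ENNReal.ofReal (D * (1 + Real.log ((ℓ : ℝ) + 1))) *
              totalEnergy (linePotential M s ℓ r) ψ 0

/-- **Eternal dark modes vanish** (qualitative composition of the two readings, per mode): a global
`C²` Regge–Wheeler solution with energy bounded for ALL `t ∈ ℝ` (eternal) and with zero two-ended
channel energy from EVERY apex `(t₀, x_c)` and every aperture `ρ ≥ 0` (dark: nothing reaches
`𝓘^±`, `𝓗^±` ahead of any light cone) is identically zero.  Proof route of the card: channels
(`FixedModeChannels`) put the data outside the ball in the `t`-polynomial kernel from every apex ⇒
polynomial in `t`, bounded ⇒ static there; the time-differences are then eternal bounded solutions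
supported in the ball ⇒ zero by local energy decay (`LogShellSmoothing` / Price law); a finite-energy
static solution of `−S″ + V S = 0`, `V > 0`, vanishes.  (Also a corollary of asymptotic completeness
of each RW mode.) [conjectural; first lemma companion] -/
def EternalDarkModesVanish : Prop :=
  ∀ M : ℝ, 0 < M → ∀ (r : ℝ → ℝ) (xc : ℝ), IsTortoiseRadius M r xc → ∀ (s ℓ : ℕ), s ≤ 2 → s ≤ ℓ →
    ∀ ψ : ℝ → ℝ → ℝ, IsRWSolution M s ℓ r ψ →
      (∃ E : ℝ, ∀ t, totalEnergy (linePotential M s ℓ r) ψ t ≤ ENNReal.ofReal E) →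
      (∀ t₀ ρ : ℝ, 0 ≤ ρ →
          channelEnergy (linePotential M s ℓ r) xc ρ (fun t x ↦ ψ (t + t₀) x) atTop = 0 ∧
          channelEnergy (linePotential M s ℓ r) xc ρ (fun t x ↦ ψ (t + t₀) x) atBot = 0) →
      ∀ t x, ψ t x = 0

/-! ## Card 3 — zero-energy light cannot hover -/

/-- Carter's radial function of a null geodesic of Kerr with ZERO Killing energy `E = −p_t = 0`,
azimuthal momentum `L` and Carter constant `Q`: `R₀(r) = a²L² − Δ(r)(Q + L²)`,
`Δ = r² − 2Mr + a²` (Carter 1968; Chandrasekhar 1983, §62, with `E = 0`). [folklore] -/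
def kerrZeroEnergyRadial (M a L Q r : ℝ) : ℝ :=
  a ^ 2 * L ^ 2 - (r ^ 2 - 2 * M * r + a ^ 2) * (Q + L ^ 2)

/-- **Zero-energy light falls in, Kerr case** (PROVED): `R₀′(r) = −2(r − M)(Q + L²)`, so for
`Q + L² > 0` the allowed region `{R₀ ≥ 0}` of a zero-energy null geodesic is an interval ending at
a single turning point and every such geodesic in `{r > r₊} ⊆ {r > M}` moves monotonically into the
horizon after at most one bounce: zero-Killing-energy null geodesics of sub-extremal Kerr are never
trapped (the geometric content of "superradiant-threshold frequencies are not trapped",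
Dafermos–Rodnianski–Shlapentokh-Rothman arXiv:1402.7034 §1, at `ω = 0·m`). [folklore] -/
theorem kerr_zeroEnergyRadial_hasDerivAt (M a L Q r : ℝ) :
    HasDerivAt (kerrZeroEnergyRadial M a L Q) (-(2 * (r - M) * (Q + L ^ 2))) r := by
  have hΔ : HasDerivAt (fun r : ℝ ↦ r ^ 2 - 2 * M * r + a ^ 2) (2 * r - 2 * M) r := by
    have h1 : HasDerivAt (fun r : ℝ ↦ r ^ 2) (2 * r) r := by
      simpa using hasDerivAt_pow 2 r
    have h2 : HasDerivAt (fun r : ℝ ↦ 2 * M * r) (2 * M) r := by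
      simpa using (hasDerivAt_id r).const_mul (2 * M)
    simpa using (h1.sub h2).add_const (a ^ 2)
  have h : HasDerivAt (fun x : ℝ ↦ a ^ 2 * L ^ 2 - (x ^ 2 - 2 * M * x + a ^ 2) * (Q + L ^ 2))
      (0 - (2 * r - 2 * M) * (Q + L ^ 2)) r :=
    (hasDerivAt_const r (a ^ 2 * L ^ 2)).sub (hΔ.mul_const (Q + L ^ 2))
  have e : (0 - (2 * r - 2 * M) * (Q + L ^ 2)) = -(2 * (r - M) * (Q + L ^ 2)) := by ring
  rw [e] at h
  exact h

/-- The radial function is strictly decreasing on `(M, ∞)` whenever `Q + L² > 0`. [folklore] -/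
theorem kerr_zeroEnergyRadial_strictAntiOn (M a L Q : ℝ) (hQL : 0 < Q + L ^ 2) :
    StrictAntiOn (kerrZeroEnergyRadial M a L Q) (Ioi M) := by
  refine strictAntiOn_of_deriv_neg (convex_Ioi M)
    (fun r _ ↦ (kerr_zeroEnergyRadial_hasDerivAt M a L Q r).continuousAt.continuousWithinAt) ?_
  intro r hr
  rw [interior_Ioi] at hr
  rw [(kerr_zeroEnergyRadial_hasDerivAt M a L Q r).deriv]
  have : 0 < r - M := sub_pos.2 hr
  nlinarith [mul_pos this hQL]

/-- **Zero-energy light falls in** (the Transfer `C⁺` of the card, general stationary case): in a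
vacuum stationary asymptotically flat black hole that is `I⁺`-regular with connected non-degenerate
horizon, no future-directed null geodesic with ZERO Killing energy `g(T, γ′) ≡ 0` stays in the domain
of outer communications for all affine parameter `t ≥ 0` — it falls through the horizon (it cannot
escape: `T` is timelike near infinity).  Equivalently: the zero-energy null geodesic flow on the
ergoregion has no future-trapped orbit.  True for Kerr, `|a| < M`
(`kerr_zeroEnergyRadial_strictAntiOn`); refutable by ONE stationary vacuum metric. [conjectural] -/
def ZeroEnergyLightFallsIn (𝓑 : StationaryAFBlackHole.{0}) : Prop :=
  ∀ [𝓑.metric.HasLeviCivita], 𝓑.metric.toPseudoRiemannianMetric.IsRicciFlat →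
    𝓑.IsIPlusRegularNonDegenerate →
    ∀ γ : ℝ → 𝓑.carrier,
      𝓑.metric.IsNullGeodesicIn 𝓑.timeOrientation 𝓑.doc γ (Ici 0) →
      (∀ t ∈ Ici (0 : ℝ), velocity (𝓡 4) γ t ≠ 0) →
      (∀ t ∈ Ici (0 : ℝ), 𝓑.metric.val (γ t) (𝓑.killing (γ t)) (velocity (𝓡 4) γ t) = 0) →
      False

/-- **No hair from infalling zero-energy light** (the card's claim that `C⁺` is what the
Ionescu–Klainerman sweep needs): the Alexakis–Ionescu–Klainerman rigidity schema of the tree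
(`AlexakisIonescuKlainermanRigidity`, smooth — no analyticity) holds at the predicate
"`I⁺`-regular, connected non-degenerate horizon, and zero-energy light falls in".  Why: with a
global stationary `T` and the Hawking collar `K` (from the bifurcate structure that `I⁺`-regularity
+ non-degeneracy provide), the `(T,K)`-doubly-conditional Carleman extension of `K` is unobstructed
at every point where `span{T, K}` contains a timelike vector, and the continuity sweep from the
collar can halt only on a `T`-invariant hole supporting a trapped null geodesic orthogonal to `T`;
`C⁺` says there is none, so `K` is global, the hole is axisymmetric, and smooth
stationary-axisymmetric uniqueness (`ChruscielCosta2008_uniqueness` minus analyticity) finishes.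
[conjectural; the card's Transfer] -/
def NoHairFromInfallingZeroEnergyLight : Prop :=
  AlexakisIonescuKlainermanRigidity.{0}
    (fun 𝓑 ↦ 𝓑.IsIPlusRegularNonDegenerate ∧ ZeroEnergyLightFallsIn 𝓑)

end Summit.FinalStateConjecture.FinalStateConjecture.Cruxes.ChannelsResolveTameDevelopmentsR.Ideator3
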